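import Summits.QuantumFields.YangMills.Theses.ConvexGribovBody
import Summits.QuantumFields.YangMills.Theses.SmallCircleAnchor
import Summits.QuantumFields.YangMills.Theses.EquipartitionCriticality
import HarnessLib

/-!
# `ContinuumLegGivenGap` (stmt-QuantumFields-8782): its place in the existence web, and the dock

Support file for the crux item stmt-QuantumFields-8782 (routes `ConvexGribovBody`, rank 5, and
`SmallCircleAnchor`, rank 4 — the two route declarations are the same proposition,
`smallCircleAnchor_continuumLegGivenGap_iff`), recorded by the line lead of line `Sketch`
(`Cruxes/ContinuumLegGivenGap/Lines/Sketch.lean`, `PICKED.md`).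

The crux says, for every compact simple `G` with its Borel σ-algebra: IF for every faithful unitary `r`
the Wilson torus measures cluster exponentially in Euclidean time at every `β ≥ β₀(r)` — at EACH `β` some
rate `m(β) > 0`, some volume threshold `S₁(β)`, and PER-PAIR, PER-β constants `C(A,B,β)` — THEN the
`YangMills` existential holds for `G`.

* `continuumLegGivenGap_of_yangMills`: `YangMills → ContinuumLegGivenGap` (discard the hypothesis: the
  crux is one quantifier weaker than the sub-problem statement itself).
* `criticalContinuumLimit_of_continuumLegGivenGap`: `ContinuumLegGivenGap → CriticalContinuumLimit`
  (stmt-QuantumFields-8762, route `EquipartitionCriticality`): the hub's hypothesis (1) has β-UNIFORM pair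
  constants, a special case of the crux's. With the tree's
  `ClusteringToYangMills_of_continuumLegGivenGap` (stmt-9443) this gives `YangMills ⇒ 8782 ⇒ {8762, 9443}`.
* `stub_dock` (registered sub-goal `stub_dock` of the crux, the dock): conversely the crux FOLLOWS from the hub plus two lattice statements per
  `(G, r)` — (Q) requantisation of the crux's hypothesis into β-free pair constants (hypothesis (1) of
  8762) and (N) criticality at `β = ∞` (hypothesis (2) of 8762). This is the registered skeleton of line
  `Sketch` with its two stubs as explicit hypotheses (a conditional result; it credits nothing by itself).
* `hasLatticeMassGap_of_uniformClustering`: the only shape in which torus clustering enters the crux's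
  conclusion — ONE constant per pair for all large `k`, lattice rates `≥ Δ a_k`; this k-uniformity is what
  the crux's per-β constants do not supply except along eventually-finitely-many couplings, where
  `Literature.Barriers.QuantumFields.FixedCouplingUltralocality_holds` forbids `IsNontrivial` — the reason
  the dock must pass through (Q) and (N).

Pure logic over the route declarations and `HasLatticeMassGap`; no definitions, no facts.
-/

namespace Summit.QuantumFields.YangMills.Theorems.ContinuumLegGivenGap

open Filter
open Literature.MathematicalPhysics.QuantumFieldTheory
open Summit.QuantumFields.YangMills.Theses

/-- The shared item's two route declarations (`SmallCircleAnchor`, `ConvexGribovBody`) are the same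
proposition. [folklore] -/
theorem smallCircleAnchor_continuumLegGivenGap_iff :
    SmallCircleAnchor.ContinuumLegGivenGap ↔ ConvexGribovBody.ContinuumLegGivenGap :=
  Iff.rfl

/-- **`YangMills ⇒ ContinuumLegGivenGap`**: the sub-problem statement is the crux with its lattice-gap
hypothesis discarded. [folklore] -/
theorem continuumLegGivenGap_of_yangMills (h : YangMills) : ConvexGribovBody.ContinuumLegGivenGap := by
  intro G _ _ _ _ hG
  letI : MeasurableSpace G := borel G
  haveI : BorelSpace G := ⟨rfl⟩
  intro _
  exact h G hG

/-- **`ContinuumLegGivenGap ⇒ CriticalContinuumLimit`** (stmt-8782 dominates stmt-8762): the hub assumes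
MORE — β-uniform pair constants (which are in particular per-β constants) and criticality (unused).
[folklore] -/
theorem criticalContinuumLimit_of_continuumLegGivenGap (h : ConvexGribovBody.ContinuumLegGivenGap) :
    EquipartitionCriticality.CriticalContinuumLimit := by
  intro G _ _ _ _ hG
  letI : MeasurableSpace G := borel G
  haveI : BorelSpace G := ⟨rfl⟩
  intro h₁ _
  refine h G hG fun r => ?_
  obtain ⟨β₁, m, S₀, hm, hC⟩ := h₁ r
  refine ⟨β₁, fun β hβ => ⟨m β, hm β hβ, S₀ β, fun A B => ?_⟩⟩
  obtain ⟨C, hC⟩ := hC A B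
  exact ⟨C, fun S n hS hn => hC β hβ S n hS hn⟩

/-- **The dock** (skeleton of line `Sketch` with its stubs as hypotheses): if at every compact simple
`(G, r)` (Q) the crux's per-β, per-pair torus clustering upgrades to β-FREE pair constants with a rate
function and a threshold function (hypothesis (1) of stmt-8762), and (N) every admissible volume-uniform
clustering rate function tends to `0` (hypothesis (2) of stmt-8762), then the hub `CriticalContinuumLimit`
(stmt-8762) implies the crux: feed the hub representation by representation. Conditional result (both
lattice statements and the hub are open). [folklore] -/
theorem stub_dock :
    (∀ (G : Type) [Group G] [TopologicalSpace G] [IsTopologicalGroup G] [CompactSpace G]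
      [MeasurableSpace G] [BorelSpace G], IsCompactSimpleLieGroup G → ∀ r : LatticeRep G,
      (∃ β₀ : ℝ, ∀ β : ℝ, β₀ ≤ β → ∃ m : ℝ, 0 < m ∧ ∃ S₁ : ℕ, ∀ A B : YMSpecies G, ∃ C : ℝ,
        ∀ S n : ℕ, S₁ ≤ S → n ≤ S →
          |latticeConnectedCorr r.ρ β (2 * S + 1) A.F B.F n| ≤ C * Real.exp (-(m * n))) →
      ∃ (β₁ : ℝ) (m : ℝ → ℝ) (S₀ : ℝ → ℕ), (∀ β : ℝ, β₁ ≤ β → 0 < m β) ∧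
        ∀ A B : YMSpecies G, ∃ C : ℝ, ∀ β : ℝ, β₁ ≤ β → ∀ S n : ℕ, S₀ β ≤ S → n ≤ S →
          |latticeConnectedCorr r.ρ β (2 * S + 1) A.F B.F n| ≤ C * Real.exp (-(m β * n))) →
    (∀ (G : Type) [Group G] [TopologicalSpace G] [IsTopologicalGroup G] [CompactSpace G]
      [MeasurableSpace G] [BorelSpace G], IsCompactSimpleLieGroup G → ∀ r : LatticeRep G,
      (∃ β₀ : ℝ, ∀ β : ℝ, β₀ ≤ β → ∃ m : ℝ, 0 < m ∧ ∃ S₁ : ℕ, ∀ A B : YMSpecies G, ∃ C : ℝ,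
        ∀ S n : ℕ, S₁ ≤ S → n ≤ S →
          |latticeConnectedCorr r.ρ β (2 * S + 1) A.F B.F n| ≤ C * Real.exp (-(m * n))) →
      ∀ (β₁ : ℝ) (m : ℝ → ℝ),
        (∀ β : ℝ, β₁ ≤ β → 0 < m β ∧ (∃ S₀ : ℕ, ∀ A B : YMSpecies G, ∃ C : ℝ, ∀ S n : ℕ,
          S₀ ≤ S → n ≤ S →
            |latticeConnectedCorr r.ρ β (2 * S + 1) A.F B.F n| ≤ C * Real.exp (-(m β * n)))) →
        ∀ m₀ : ℝ, 0 < m₀ → ∀ᶠ β : ℝ in atTop, m β < m₀) →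
    EquipartitionCriticality.CriticalContinuumLimit → ConvexGribovBody.ContinuumLegGivenGap := by
  intro hQ hN hHub G _ _ _ _ hG
  letI : MeasurableSpace G := borel G
  haveI : BorelSpace G := ⟨rfl⟩
  intro hH
  exact hHub G hG (fun r => hQ G hG r (hH r)) (fun r => hN G hG r (hH r))

/-- **The lattice-gap clause from k-uniform clustering** (bookkeeping for every assembly of the crux):
if along the scheme every pair of local observables clusters at the couplings `β_k` with ONE constant
for all large `k`, at lattice rates `μ_k ≥ Δ a_k`, on all tori `S ≥ L_k`, `n ≤ S`, then
`HasLatticeMassGap r sch Δ`. [folklore] -/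
theorem hasLatticeMassGap_of_uniformClustering {G : Type} [Group G] [TopologicalSpace G]
    [IsTopologicalGroup G] [CompactSpace G] [MeasurableSpace G] [BorelSpace G] {ι : Type}
    (r : LatticeRep G) (sch : SpeciesScheme ι) (Δ : ℝ) (μ : ℕ → ℝ)
    (hμ : ∀ᶠ k in atTop, Δ * sch.a k ≤ μ k)
    (h : ∀ A B : YMSpecies G, ∃ C : ℝ, ∀ᶠ k in atTop, ∀ S : ℕ, sch.L k ≤ S → ∀ n : ℕ, n ≤ S →
      |latticeConnectedCorr r.ρ (sch.β k) (2 * S + 1) A.F B.F n| ≤ C * Real.exp (-(μ k * n))) :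
    HasLatticeMassGap r sch Δ := by
  intro A B
  obtain ⟨C, hC⟩ := h A B
  refine ⟨max C 0, ?_⟩
  filter_upwards [hC, hμ] with k hk hk' S hS n hn
  refine (hk S hS n hn).trans ?_
  have h1 : Real.exp (-(μ k * n)) ≤ Real.exp (-(Δ * (sch.a k * n))) := by
    apply Real.exp_le_exp.2
    have hn0 : (0 : ℝ) ≤ n := Nat.cast_nonneg n
    nlinarith [mul_le_mul_of_nonneg_right hk' hn0]
  calc C * Real.exp (-(μ k * n)) ≤ max C 0 * Real.exp (-(μ k * n)) :=
        mul_le_mul_of_nonneg_right (le_max_left _ _) (Real.exp_pos _).le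
    _ ≤ max C 0 * Real.exp (-(Δ * (sch.a k * n))) :=
        mul_le_mul_of_nonneg_left h1 (le_max_right _ _)

end Summit.QuantumFields.YangMills.Theorems.ContinuumLegGivenGap
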